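import Summits.NavierStokesRegularity.NavierStokesRegularity.Theses.RellichScar
import Summits.NavierStokesRegularity.NavierStokesRegularity.Theorems.ScarRigidity.Negative.LogicAndLoadBearing
import Literature.Analysis.FluidPDE.TypeIAncientMild
import Literature.Analysis.FluidPDE.ParasiticSlabFlow
import Literature.Analysis.FluidPDE.NewtonLocalPotential
import Summits.NavierStokesRegularity.NavierStokesRegularity.Theorems.RellichScarScarRigidityCoulombKernel
import HarnessLib

/-!
# `ScarRigidity` — line `finite-energy-log-convexity`, stub `stub_coulombEnergyPackage`:
# the Newtonian potential of an apex density is `C²` and solves Poisson's equation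
# (crux stmt-NavierStokesRegularity-11717)

Helper file 3 of S4-E (`stub_coulombEnergyPackage`). For a `C²` density `w : ℝ³ → ℝ³` with the
apex decay `‖w(y)‖ ≤ A/(‖y‖ + a)³` (`a > 0`; no compact support, not even `L¹`), the Newtonian
potential `ψ(x) = ∫ Γ(x - y) w(y) dy` (`Γ = newtonKernel = -1/(4π|z|)`) converges absolutely, is
`C²`, and `Δψ = w`. The kernel is split at the fixed radii `(1, 2)`, `Γ = Γ₀ + Γ∞`
(`newtonNear`/`newtonFar`):

* **near part** `ψ₀(x) = ∫ Γ₀(z) w(x - z) dz`: derivatives fall on the density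
  (`HarmonicProbe.contDiff_integral_smul_comp_sub`), and `Δψ₀ = w - λ ⋆ w` with `λ = ΔΓ∞` the
  smoothing kernel (`laplacian_integral_smul_comp_sub`, `integral_newtonNear_smul_laplacian_comp_sub`:
  vector versions of the tree's `laplacian_integral_mul_comp_sub`, `newtonNearPotential_laplacian`);
* **far part** `ψ∞(x) = ∫ Γ∞(x - y) w(y) dy`: derivatives fall on the smooth kernel, dominated by
  `(1 + ‖x-y‖)⁻² ρ(y)⁻³ ∈ L¹` (`hasFDerivAt_integral_kernel_sub_smul`, twice), and
  `Δψ∞ = λ ⋆ w`;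
* `contDiff_two_newtonPotential`, `laplacian_newtonPotential` — **`ψ ∈ C²`, `Δψ = w`**, with the
  derivative formulas `fderiv_newtonPotential_apply`, `fderiv_fderiv_newtonPotential_apply` consumed
  by the decay estimates of the package.
-/

noncomputable section

open Set Filter Function MeasureTheory Metric TopologicalSpace
open scoped Topology ENNReal NNReal InnerProductSpace RealInnerProductSpace
open Literature.Analysis.FluidPDE
open Summit.NavierStokesRegularity.NavierStokesRegularity.Theses.RellichScar
open Summit.NavierStokesRegularity.NavierStokesRegularity.Theorems.ScarRigidity.Negative

set_option linter.dupNamespace false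

namespace Summit.NavierStokesRegularity.NavierStokesRegularity.Theorems.RellichScarScarRigidity

open Real
open scoped Laplacian

/-! ## The near part: derivatives on the density -/

/-- **The Laplacian passes under the integral** (vector-valued density): for `k ∈ L¹` vanishing off
a ball and `g ∈ C²(ℝ³; ℝ³)`, `Δ(∫ k(z) • g(· - z) dz)(x) = ∫ k(z) • (Δg)(x - z) dz` (the tree's
`laplacian_integral_mul_comp_sub` for scalar `g`). [folklore] -/
theorem laplacian_integral_smul_comp_sub {k : (EuclideanSpace ℝ (Fin 3)) → ℝ} {ρ : ℝ}
    (hk : Integrable k) (hkρ : ∀ z, ρ < ‖z‖ → k z = 0)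
    {g : (EuclideanSpace ℝ (Fin 3)) → (EuclideanSpace ℝ (Fin 3))} (hg : ContDiff ℝ 2 g)
    (x : EuclideanSpace ℝ (Fin 3)) :
    (Δ (fun x => ∫ z, k z • g (x - z))) x = ∫ z, k z • (Δ g) (x - z) := by
  set b := EuclideanSpace.basisFun (Fin 3) ℝ
  have hg1 : ContDiff ℝ 1 g := hg.of_le one_le_two
  have hgi : ∀ i, ContDiff ℝ 1 fun w => fderiv ℝ g w (b i) := fun i =>
    (hg.fderiv_right (m := 1) le_rfl).clm_apply contDiff_const
  have hQ : ContDiff ℝ 2 fun x => ∫ z, k z • g (x - z) := contDiff_integral_smul_comp_sub hk hkρ 2 hg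
  rw [laplacian_eq_sum_fderiv_fderiv b hQ x]
  have h1 : ∀ i, (fun y => fderiv ℝ (fun x => ∫ z, k z • g (x - z)) y (b i)) =
      fun y => ∫ z, k z • (fun w => fderiv ℝ g w (b i)) (y - z) := fun i =>
    funext fun y => fderiv_integral_smul_comp_sub_apply hk hkρ hg1 y _
  simp_rw [h1]
  have h2 : ∀ i, fderiv ℝ (fun y => ∫ z, k z • (fun w => fderiv ℝ g w (b i)) (y - z)) x (b i) =
      ∫ z, k z • fderiv ℝ (fun w => fderiv ℝ g w (b i)) (x - z) (b i) := fun i =>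
    fderiv_integral_smul_comp_sub_apply hk hkρ (hgi i) x (b i)
  simp_rw [h2]
  rw [← integral_finsetSum]
  · refine integral_congr_ae (Eventually.of_forall fun z => ?_)
    dsimp only
    rw [← Finset.smul_sum, laplacian_eq_sum_fderiv_fderiv b hg (x - z)]
  · intro i _
    exact integrable_smul_comp_sub hk hkρ ((hgi i).continuous_fderiv one_ne_zero |>.clm_apply
      continuous_const) x

/-- **Green's representation at scale `(1, 2)`, vector form**: for `w ∈ C²(ℝ³; ℝ³)`,
`∫ Γ₀(z) • (Δw)(x - z) dz = w(x) - ∫ λ(z) • w(x - z) dz` (coordinatewise the tree's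
`newtonNearPotential_laplacian`; Gilbarg–Trudinger (2.17), localised). [cite: GilbargTrudinger2001, (2.17)] -/
theorem integral_newtonNear_smul_laplacian_comp_sub
    {w : (EuclideanSpace ℝ (Fin 3)) → (EuclideanSpace ℝ (Fin 3))} (hw : ContDiff ℝ 2 w)
    (x : EuclideanSpace ℝ (Fin 3)) :
    ∫ z, newtonNear 1 2 z • (Δ w) (x - z) =
      w x - ∫ z, newtonFarLaplacian 1 2 z • w (x - z) := by
  have hΔ : Continuous (Δ w) := Literature.Analysis.FluidPDE.continuous_laplacian hw
  have hi1 : Integrable fun z => newtonNear 1 2 z • (Δ w) (x - z) :=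
    integrable_smul_comp_sub (integrable_newtonNear zero_le_one one_lt_two)
      (newtonNear_eq_zero_of_lt zero_le_one one_lt_two) hΔ x
  have hi2 : Integrable fun z => newtonFarLaplacian 1 2 z • w (x - z) :=
    integrable_smul_comp_sub (integrable_newtonFarLaplacian one_pos one_lt_two)
      (newtonFarLaplacian_eq_zero_of_lt' zero_le_one one_lt_two) hw.continuous x
  ext i
  have hwi : ContDiff ℝ 2 fun y => w y i :=
    (EuclideanSpace.proj i : EuclideanSpace ℝ (Fin 3) →L[ℝ] ℝ).contDiff.comp hw
  have hcoord : ∀ y, (Δ w) y i = (Δ (fun y => w y i)) y := fun y => by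
    have h := (hw.contDiffAt (x := y)).laplacian_CLM_comp_left
      (l := (EuclideanSpace.proj i : EuclideanSpace ℝ (Fin 3) →L[ℝ] ℝ))
    simp only [EuclideanSpace.coe_proj, Function.comp_def] at h
    exact h.symm
  show (EuclideanSpace.proj i : EuclideanSpace ℝ (Fin 3) →L[ℝ] ℝ)
      (∫ z, newtonNear 1 2 z • (Δ w) (x - z)) =
    (EuclideanSpace.proj i : EuclideanSpace ℝ (Fin 3) →L[ℝ] ℝ) (w x) -
      (EuclideanSpace.proj i : EuclideanSpace ℝ (Fin 3) →L[ℝ] ℝ)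
        (∫ z, newtonFarLaplacian 1 2 z • w (x - z))
  rw [← ContinuousLinearMap.integral_comp_comm _ hi1, ← ContinuousLinearMap.integral_comp_comm _ hi2]
  simp only [map_smul, EuclideanSpace.coe_proj, smul_eq_mul, hcoord]
  have key := newtonNearPotential_laplacian (r₀ := (1 : ℝ)) (r₁ := 2) one_pos one_lt_two hwi x
  simpa only [newtonNearPotential_apply, newtonFarSmoothing_apply] using key

/-! ## The far part: derivatives on the kernel -/

/-- Continuity of `y ↦ (L(y)).smulRight (v(y))` for continuous `L`, `v`. [folklore] -/
theorem continuous_smulRight_comp {X : Type*} [TopologicalSpace X]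
    {L : X → (EuclideanSpace ℝ (Fin 3)) →L[ℝ] ℝ} {v : X → EuclideanSpace ℝ (Fin 3)}
    (hL : Continuous L) (hv : Continuous v) :
    Continuous fun y => (L y).smulRight (v y) := by
  have h := (ContinuousLinearMap.smulRightL ℝ (EuclideanSpace ℝ (Fin 3))
    (EuclideanSpace ℝ (Fin 3))).continuous₂
  exact h.comp (hL.prodMk hv)

/-- The uniform comparison of translated weights on the unit ball around `x`:
`(1 + ‖x - y‖)² ≤ 4 (1 + ‖x' - y‖)²` for `‖x' - x‖ ≤ 1`. [folklore] -/
theorem inv_sq_weight_le_of_mem_closedBall {x x' y : EuclideanSpace ℝ (Fin 3)}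
    (hx' : x' ∈ closedBall x 1) :
    ((1 + ‖x' - y‖) ^ 2)⁻¹ ≤ 4 * ((1 + ‖x - y‖) ^ 2)⁻¹ := by
  rw [mem_closedBall, dist_eq_norm] at hx'
  have h1 : ‖x - y‖ ≤ ‖x - x'‖ + ‖x' - y‖ := norm_sub_le_norm_sub_add_norm_sub x x' y
  have h2 : ‖x - x'‖ = ‖x' - x‖ := norm_sub_rev x x'
  have h3 : 1 + ‖x - y‖ ≤ 2 * (1 + ‖x' - y‖) := by linarith [norm_nonneg (x' - y)]
  have h4 : (1 + ‖x - y‖) ^ 2 ≤ 4 * (1 + ‖x' - y‖) ^ 2 := by nlinarith [norm_nonneg (x - y)]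
  rw [← div_eq_mul_inv, le_div_iff₀ (by positivity), inv_mul_le_iff₀ (by positivity)]
  linarith

/-- **Differentiation under the integral on the kernel side, decaying density.** For a scalar
kernel `k ∈ C¹(ℝ³)` with `|k(z)| ≤ K(1+‖z‖)⁻¹`, `‖Dk(z)‖ ≤ K'(1+‖z‖)⁻²` and a continuous density
`w` with `‖w(y)‖ ≤ A(‖y‖+a)⁻³` (`a > 0`): `y ↦ k(x-y) w(y)` is integrable, and
`x ↦ ∫ k(x-y) w(y) dy` has the Fréchet derivative `∫ Dk(x-y) ⊗ w(y) dy`, which is continuous in `x`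
(dominated differentiation / continuity on the unit ball around `x`, dominant
`4K'A (1+‖x-y‖)⁻² ρ(y)⁻³`). [folklore] -/
theorem hasFDerivAt_integral_kernel_sub_smul {k : (EuclideanSpace ℝ (Fin 3)) → ℝ} {K K' : ℝ}
    (hk : ContDiff ℝ 1 k) (hK : 0 ≤ K) (hK' : 0 ≤ K')
    (hkb : ∀ z, |k z| ≤ K * (1 + ‖z‖)⁻¹) (hkd : ∀ z, ‖fderiv ℝ k z‖ ≤ K' * ((1 + ‖z‖) ^ 2)⁻¹)
    {w : (EuclideanSpace ℝ (Fin 3)) → (EuclideanSpace ℝ (Fin 3))} (hwc : Continuous w)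
    {A a : ℝ} (ha : 0 < a) (hA : 0 ≤ A) (hwb : ∀ y, ‖w y‖ ≤ A * ((‖y‖ + a) ^ 3)⁻¹)
    (x : EuclideanSpace ℝ (Fin 3)) :
    Integrable (fun y => k (x - y) • w y) volume ∧
    HasFDerivAt (fun x => ∫ y, k (x - y) • w y) (∫ y, (fderiv ℝ k (x - y)).smulRight (w y)) x ∧
    ContinuousAt (fun x => ∫ y, (fderiv ℝ k (x - y)).smulRight (w y)) x := by
  have hkc : Continuous k := hk.continuous
  have hdk : Continuous (fderiv ℝ k) := hk.continuous_fderiv one_ne_zero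
  -- integrability of the translated products, at every point
  have hint : ∀ x', Integrable (fun y => k (x' - y) • w y) volume := by
    intro x'
    refine (((integrable_inv_mul_inv_cube x' ha).1).const_mul (K * A)).mono'
      ((hkc.comp (continuous_const.sub continuous_id)).smul hwc).aestronglyMeasurable
      (Eventually.of_forall fun y => ?_)
    rw [norm_smul, Real.norm_eq_abs]
    calc |k (x' - y)| * ‖w y‖ ≤ K * (1 + ‖x' - y‖)⁻¹ * (A * ((‖y‖ + a) ^ 3)⁻¹) :=
          mul_le_mul (hkb _) (hwb y) (norm_nonneg _) (by positivity)
      _ = K * A * ((1 + ‖x' - y‖)⁻¹ * ((‖y‖ + a) ^ 3)⁻¹) := by ring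
  -- the dominant of the derivative on the unit ball around `x`
  set bound : (EuclideanSpace ℝ (Fin 3)) → ℝ :=
    fun y => 4 * K' * A * (((1 + ‖x - y‖) ^ 2)⁻¹ * ((‖y‖ + a) ^ 3)⁻¹) with hbound
  have hbound_int : Integrable bound volume :=
    ((integrable_inv_pow_mul_inv_cube x ha (le_refl 2)).1).const_mul _
  have hF'b : ∀ y, ∀ x' ∈ closedBall x 1, ‖(fderiv ℝ k (x' - y)).smulRight (w y)‖ ≤ bound y := by
    intro y x' hx'
    rw [ContinuousLinearMap.norm_smulRight_apply]
    calc ‖fderiv ℝ k (x' - y)‖ * ‖w y‖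
        ≤ K' * ((1 + ‖x' - y‖) ^ 2)⁻¹ * (A * ((‖y‖ + a) ^ 3)⁻¹) :=
          mul_le_mul (hkd _) (hwb y) (norm_nonneg _) (by positivity)
      _ ≤ K' * (4 * ((1 + ‖x - y‖) ^ 2)⁻¹) * (A * ((‖y‖ + a) ^ 3)⁻¹) := by
          gcongr
          exact inv_sq_weight_le_of_mem_closedBall hx'
      _ = bound y := by simp only [hbound]; ring
  have hF'm : ∀ x', AEStronglyMeasurable (fun y => (fderiv ℝ k (x' - y)).smulRight (w y)) volume :=
    fun x' => (continuous_smulRight_comp (hdk.comp (continuous_const.sub continuous_id))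
      hwc).aestronglyMeasurable
  have hdiff : ∀ y, ∀ x' ∈ closedBall x 1,
      HasFDerivAt (fun x' => k (x' - y) • w y) ((fderiv ℝ k (x' - y)).smulRight (w y)) x' := by
    intro y x' _
    have h1 : HasFDerivAt (fun x' => k (x' - y)) (fderiv ℝ k (x' - y)) x' := by
      have := ((hk.differentiable one_ne_zero) (x' - y)).hasFDerivAt.comp x'
        (hasFDerivAt_sub_const y)
      rwa [ContinuousLinearMap.comp_id] at this
    exact h1.smul_const (w y)
  refine ⟨hint x, ?_, ?_⟩
  · exact hasFDerivAt_integral_of_dominated_of_fderiv_le (F := fun x' y => k (x' - y) • w y)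
      (F' := fun x' y => (fderiv ℝ k (x' - y)).smulRight (w y)) (closedBall_mem_nhds x one_pos)
      (Eventually.of_forall fun x' =>
        ((hkc.comp (continuous_const.sub continuous_id)).smul hwc).aestronglyMeasurable)
      (hint x) (hF'm x) (Eventually.of_forall hF'b) hbound_int (Eventually.of_forall hdiff)
  · refine continuousAt_of_dominated (Eventually.of_forall hF'm) ?_ hbound_int
      (Eventually.of_forall fun y => ((continuous_smulRight_comp
        (hdk.comp (continuous_id.sub continuous_const)) continuous_const).continuousAt))
    filter_upwards [closedBall_mem_nhds x one_pos] with x' hx'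
    exact Eventually.of_forall fun y => hF'b y x' hx'

/-- The far kernel at radii `(1, 2)` is `C¹` with the bounds of `hasFDerivAt_integral_kernel_sub_smul`
for itself and for its directional derivatives `∂ₐΓ∞`: there are `K₀, K₁, K₂ ≥ 0` with
`|Γ∞| ≤ K₀(1+‖z‖)⁻¹`, `‖DΓ∞‖ ≤ K₁(1+‖z‖)⁻²`, `|∂ₐΓ∞| ≤ K₁‖a‖(1+‖z‖)⁻¹`,
`‖D∂ₐΓ∞‖ ≤ K₂‖a‖(1+‖z‖)⁻²`. [folklore] -/
theorem exists_newtonFar_kernel_bounds :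
    ∃ K₀ K₁ K₂ : ℝ, 0 ≤ K₀ ∧ 0 ≤ K₁ ∧ 0 ≤ K₂ ∧
      (∀ z : EuclideanSpace ℝ (Fin 3), |newtonFar 1 2 z| ≤ K₀ * (1 + ‖z‖)⁻¹) ∧
      (∀ z : EuclideanSpace ℝ (Fin 3), ‖fderiv ℝ (newtonFar 1 2) z‖ ≤ K₁ * ((1 + ‖z‖) ^ 2)⁻¹) ∧
      (∀ z a : EuclideanSpace ℝ (Fin 3), |fderiv ℝ (newtonFar 1 2) z a| ≤ K₁ * ‖a‖ * (1 + ‖z‖)⁻¹) ∧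
      (∀ z a : EuclideanSpace ℝ (Fin 3),
        ‖fderiv ℝ (fun y => fderiv ℝ (newtonFar 1 2) y a) z‖ ≤ K₂ * ‖a‖ * ((1 + ‖z‖) ^ 2)⁻¹) := by
  obtain ⟨K₀, hK₀, h0⟩ := exists_abs_newtonFar_le
  obtain ⟨K₁, hK₁, h1⟩ := exists_norm_fderiv_newtonFar_le
  obtain ⟨K₂, hK₂, h2⟩ := exists_norm_fderiv_fderiv_newtonFar_apply_le
  refine ⟨K₀, K₁, K₂, hK₀, hK₁, hK₂, h0, h1, fun z a => ?_, fun z a => ?_⟩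
  · have hz1 : (1 : ℝ) ≤ 1 + ‖z‖ := by linarith [norm_nonneg z]
    calc |fderiv ℝ (newtonFar 1 2) z a| = ‖fderiv ℝ (newtonFar 1 2) z a‖ := (Real.norm_eq_abs _).symm
      _ ≤ ‖fderiv ℝ (newtonFar 1 2) z‖ * ‖a‖ := ContinuousLinearMap.le_opNorm _ _
      _ ≤ K₁ * ((1 + ‖z‖) ^ 2)⁻¹ * ‖a‖ := mul_le_mul_of_nonneg_right (h1 z) (norm_nonneg _)
      _ ≤ K₁ * (1 + ‖z‖)⁻¹ * ‖a‖ := by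
          have h : ((1 + ‖z‖) ^ 2)⁻¹ ≤ (1 + ‖z‖)⁻¹ :=
            inv_anti₀ (by positivity : (0 : ℝ) < 1 + ‖z‖) (by nlinarith : 1 + ‖z‖ ≤ (1 + ‖z‖) ^ 2)
          exact mul_le_mul_of_nonneg_right (mul_le_mul_of_nonneg_left h hK₁) (norm_nonneg _)
      _ = K₁ * ‖a‖ * (1 + ‖z‖)⁻¹ := by ring
  · have hz1 : (1 : ℝ) ≤ 1 + ‖z‖ := by linarith [norm_nonneg z]
    calc ‖fderiv ℝ (fun y => fderiv ℝ (newtonFar 1 2) y a) z‖ ≤ K₂ * ‖a‖ * ((1 + ‖z‖) ^ 3)⁻¹ :=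
          h2 z a
      _ ≤ K₂ * ‖a‖ * ((1 + ‖z‖) ^ 2)⁻¹ :=
          mul_le_mul_of_nonneg_left (inv_anti₀ (by positivity : (0 : ℝ) < (1 + ‖z‖) ^ 2)
            (pow_le_pow_right₀ hz1 (by norm_num : 2 ≤ 3))) (mul_nonneg hK₂ (norm_nonneg _))

/-! ## Registered sub-goal (helper stub of `stub_coulombEnergyPackage`) -/

/-- **Registered helper stub `stub_newtonFarKernelDifferentiation`** (crux
stmt-NavierStokesRegularity-11717, line `finite-energy-log-convexity`, helper of S4-E):
differentiation under the integral on the kernel side against an apex density, as registered. [folklore] -/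
theorem stub_newtonFarKernelDifferentiation :
    ∀ (k : EuclideanSpace ℝ (Fin 3) → ℝ) (w : EuclideanSpace ℝ (Fin 3) → EuclideanSpace ℝ (Fin 3))
      (K K' A a : ℝ) (x : EuclideanSpace ℝ (Fin 3)), ContDiff ℝ 1 k → 0 ≤ K → 0 ≤ K' →
      (∀ z, |k z| ≤ K * (1 + ‖z‖)⁻¹) → (∀ z, ‖fderiv ℝ k z‖ ≤ K' * ((1 + ‖z‖) ^ 2)⁻¹) →
      Continuous w → 0 < a → 0 ≤ A → (∀ y, ‖w y‖ ≤ A * ((‖y‖ + a) ^ 3)⁻¹) →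
      Integrable (fun y => k (x - y) • w y) volume ∧
      HasFDerivAt (fun x => ∫ y, k (x - y) • w y) (∫ y, (fderiv ℝ k (x - y)).smulRight (w y)) x ∧
      ContinuousAt (fun x => ∫ y, (fderiv ℝ k (x - y)).smulRight (w y)) x :=
  fun _k _w _K _K' _A _a x hk hK hK' hkb hkd hwc ha hA hwb =>
    hasFDerivAt_integral_kernel_sub_smul hk hK hK' hkb hkd hwc ha hA hwb x

end Summit.NavierStokesRegularity.NavierStokesRegularity.Theorems.RellichScarScarRigidity

end
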